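import Summits.PneNP.PneNP.Theorems.EcdlpDefinabilityDefs

/-!
# Route EcdlpDefinability — the residue-level group law is Mathlib's (helper for `EcdlpInNP`, stmt-PneNP-2075)

For a prime modulus `p` and a Weierstrass curve `W/𝔽_p` with coefficients the residues `a₁, …, a₄` (and any `a₆`):
`ecdlpAdd` represents `P + Q` (`ecdlp_pt_add`, by the case split of `WeierstrassCurve.Affine.Point.add` and the
explicit `slope/addX/addY` formulas), and double-and-add `ecdlpSmul` represents `m • P` once `m < 2^B`
(`ecdlp_pt_smul`). Also the size invariant of the loop for every modulus `≥ 1` (`ecdlp_foldl_small`).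
-/

set_option linter.dupNamespace false -- `Summit.PneNP.PneNP.…`: summit = sub-problem name (D-0017 single-conjunct layout)

namespace Summit.PneNP.PneNP.Theorems

open Literature.Computability.Complexity.ModArith

/-! ### Size invariant (any modulus `≥ 1`) -/

/-- `ecdlpAdd` keeps flags `≤ 1` and coordinates `< q`. [folklore] -/
theorem ecdlp_add_small {q a₁ a₂ a₃ a₄ : ℕ} (hq : 1 ≤ q) {u v : ℕ × ℕ × ℕ} (hu : u.1 ≤ 1 ∧ u.2.1 < q ∧ u.2.2 < q)
    (hv : v.1 ≤ 1 ∧ v.2.1 < q ∧ v.2.2 < q) :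
    (ecdlpAdd q a₁ a₂ a₃ a₄ u v).1 ≤ 1 ∧ (ecdlpAdd q a₁ a₂ a₃ a₄ u v).2.1 < q ∧ (ecdlpAdd q a₁ a₂ a₃ a₄ u v).2.2 < q := by
  unfold ecdlpAdd
  split_ifs
  · exact hv
  · exact hu
  · exact ⟨Nat.zero_le 1, hq, hq⟩
  · exact ⟨le_rfl, Nat.mod_lt _ (by omega), Nat.mod_lt _ (by omega)⟩

/-- The double-and-add loop keeps flags `≤ 1` and coordinates `< q`. [folklore] -/
theorem ecdlp_foldl_small {q a₁ a₂ a₃ a₄ m : ℕ} (hq : 1 ≤ q) : ∀ (l : List ℕ) (st : (ℕ × ℕ × ℕ) × (ℕ × ℕ × ℕ)),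
    (st.1.1 ≤ 1 ∧ st.1.2.1 < q ∧ st.1.2.2 < q) → (st.2.1 ≤ 1 ∧ st.2.2.1 < q ∧ st.2.2.2 < q) →
    ((l.foldl (fun st i => ecdlpStep q a₁ a₂ a₃ a₄ m i st) st).1.1 ≤ 1 ∧
      (l.foldl (fun st i => ecdlpStep q a₁ a₂ a₃ a₄ m i st) st).1.2.1 < q ∧
      (l.foldl (fun st i => ecdlpStep q a₁ a₂ a₃ a₄ m i st) st).1.2.2 < q) ∧
    ((l.foldl (fun st i => ecdlpStep q a₁ a₂ a₃ a₄ m i st) st).2.1 ≤ 1 ∧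
      (l.foldl (fun st i => ecdlpStep q a₁ a₂ a₃ a₄ m i st) st).2.2.1 < q ∧
      (l.foldl (fun st i => ecdlpStep q a₁ a₂ a₃ a₄ m i st) st).2.2.2 < q)
  | [], st, h1, h2 => ⟨h1, h2⟩
  | i :: l, st, h1, h2 => by
    rw [List.foldl_cons]
    refine ecdlp_foldl_small hq l _ ?_ ?_
    · dsimp only [ecdlpStep]
      split_ifs
      · exact ecdlp_add_small hq h1 h2
      · exact h1
    · dsimp only [ecdlpStep]
      exact ecdlp_add_small hq h2 h2

/-! ### The represented point -/

section Pt

variable {p : ℕ} (W : WeierstrassCurve.Affine (ZMod p))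

/-- `(0, 0, 0)` is the point at infinity. [folklore] -/
theorem ecdlp_pt_zero : ecdlpPt W (0, 0, 0) = some 0 := by
  unfold ecdlpPt
  rw [if_pos rfl]

/-- `(1, x, y)` with canonical residues is the affine point `(x, y)` when nonsingular. [folklore] -/
theorem ecdlp_pt_affine {x y : ℕ} (hx : x < p) (hy : y < p) (h : W.Nonsingular (x : ZMod p) (y : ZMod p)) :
    ecdlpPt W (1, x, y) = some (WeierstrassCurve.Affine.Point.some (x : ZMod p) (y : ZMod p) h) := by
  unfold ecdlpPt
  rw [if_neg (by simp), dif_pos ⟨rfl, hx, hy, h⟩]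

/-- `(1, x, y)` represents nothing unless `(x, y)` is nonsingular. [folklore] -/
theorem ecdlp_pt_affine_none {x y : ℕ} (h : ¬ W.Nonsingular (x : ZMod p) (y : ZMod p)) : ecdlpPt W (1, x, y) = none := by
  unfold ecdlpPt
  rw [if_neg (by simp), dif_neg (fun h' => h h'.2.2.2)]

/-- Inversion: what a represented point looks like. [folklore] -/
theorem ecdlp_pt_eq_some {u : ℕ × ℕ × ℕ} {P : W.Point} (h : ecdlpPt W u = some P) :
    (u = (0, 0, 0) ∧ P = 0) ∨ ∃ x y : ℕ, u = (1, x, y) ∧ x < p ∧ y < p ∧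
      ∃ hn : W.Nonsingular (x : ZMod p) (y : ZMod p), P = WeierstrassCurve.Affine.Point.some (x : ZMod p) (y : ZMod p) hn := by
  unfold ecdlpPt at h
  split_ifs at h with h0 h1
  · exact Or.inl ⟨h0, (Option.some.inj h).symm⟩
  · right
    obtain ⟨f, x, y⟩ := u
    obtain ⟨hf, hx, hy, hn⟩ := h1
    dsimp only at hf hx hy hn h
    subst hf
    exact ⟨x, y, rfl, hx, hy, hn, (Option.some.inj h).symm⟩

/-- Canonical residues are equal in `𝔽_p` iff equal. [folklore] -/
theorem ecdlp_natCast_inj {x y : ℕ} (hx : x < p) (hy : y < p) : (x : ZMod p) = y ↔ x = y := by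
  rw [ZMod.natCast_eq_natCast_iff', Nat.mod_eq_of_lt hx, Nat.mod_eq_of_lt hy]

variable [Fact p.Prime] {a₁ a₂ a₃ a₄ : ℕ}

/-- `ecdlpNegY` is `negY`. [cite: SilvermanAEC2009, III.2.3] -/
theorem ecdlp_natCast_negY (h₁ : W.a₁ = a₁) (h₃ : W.a₃ = a₃) (x y : ℕ) :
    (ecdlpNegY p a₁ a₃ x y : ZMod p) = W.negY x y := by
  rw [ecdlpNegY, natCast_subM, natCast_subM, natCast_negM, natCast_mulM, WeierstrassCurve.Affine.negY, h₁, h₃]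

/-- `ecdlpAddX` is `addX`. [cite: SilvermanAEC2009, III.2.3] -/
theorem ecdlp_natCast_addX (h₁ : W.a₁ = a₁) (h₂ : W.a₂ = a₂) (x₁ x₂ L : ℕ) :
    (ecdlpAddX p a₁ a₂ x₁ x₂ L : ZMod p) = W.addX x₁ x₂ L := by
  rw [ecdlpAddX, natCast_subM, natCast_subM, natCast_subM, natCast_addM, natCast_mulM, natCast_mulM,
    WeierstrassCurve.Affine.addX, h₁, h₂]
  ring

/-- `ecdlpAddY` is `negY X (L(X - x₁) + y₁)`. [cite: SilvermanAEC2009, III.2.3] -/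
theorem ecdlp_natCast_addY (h₁ : W.a₁ = a₁) (h₃ : W.a₃ = a₃) (x₁ y₁ X L : ℕ) :
    (ecdlpAddY p a₁ a₃ x₁ y₁ X L : ZMod p) = W.negY X (L * (X - x₁) + y₁) := by
  rw [ecdlpAddY, ecdlp_natCast_negY W h₁ h₃, natCast_addM, natCast_mulM, natCast_subM]

/-- `ecdlpSlope` is `slope` for two points of the curve not on a vertical line. [cite: SilvermanAEC2009, III.2.3] -/
theorem ecdlp_natCast_slope [DecidableEq (ZMod p)] (h₁ : W.a₁ = a₁) (h₂ : W.a₂ = a₂) (h₃ : W.a₃ = a₃) (h₄ : W.a₄ = a₄)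
    {x₁ y₁ x₂ y₂ : ℕ} (hx₁ : x₁ < p) (hx₂ : x₂ < p) (e₁ : W.Equation (x₁ : ZMod p) (y₁ : ZMod p))
    (e₂ : W.Equation (x₂ : ZMod p) (y₂ : ZMod p)) (hxy : ¬ ((x₁ : ZMod p) = x₂ ∧ (y₁ : ZMod p) = W.negY x₂ y₂)) :
    (ecdlpSlope p a₁ a₂ a₃ a₄ x₁ y₁ x₂ y₂ : ZMod p) = W.slope x₁ x₂ y₁ y₂ := by
  unfold ecdlpSlope
  by_cases hx : x₁ = x₂
  · subst hx
    rw [if_pos rfl]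
    have hy : (y₁ : ZMod p) ≠ W.negY x₁ y₂ := fun h => hxy ⟨rfl, h⟩
    have hyy : (y₁ : ZMod p) = y₂ := (WeierstrassCurve.Affine.Y_eq_of_X_eq e₁ e₂ rfl).resolve_right hy
    have hD : ((subM p y₁ (ecdlpNegY p a₁ a₃ x₁ y₁) : ℕ) : ZMod p) ≠ 0 := by
      rw [natCast_subM, ecdlp_natCast_negY W h₁ h₃, sub_ne_zero]
      intro h
      apply hy
      rw [← hyy]
      exact h
    rw [WeierstrassCurve.Affine.slope_of_Y_ne rfl hy, natCast_mulM, natCast_invM _ (Or.inl hD), div_eq_mul_inv]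
    simp only [natCast_subM, natCast_addM, natCast_mulM, ecdlp_natCast_negY W h₁ h₃, WeierstrassCurve.Affine.negY,
      h₁, h₂, h₃, h₄]
    push_cast
    ring
  · have hx' : (x₁ : ZMod p) ≠ x₂ := fun h => hx ((ecdlp_natCast_inj hx₁ hx₂).1 h)
    rw [if_neg hx, WeierstrassCurve.Affine.slope_of_X_ne hx', natCast_mulM, natCast_subM,
      natCast_invM _ (Or.inl (by rwa [natCast_subM, sub_ne_zero])), natCast_subM, div_eq_mul_inv]

/-- **`ecdlpAdd` represents `P + Q`** (the case split of `WeierstrassCurve.Affine.Point.add`).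
[cite: SilvermanAEC2009, III.2.3] -/
theorem ecdlp_pt_add [DecidableEq (ZMod p)] (h₁ : W.a₁ = a₁) (h₂ : W.a₂ = a₂) (h₃ : W.a₃ = a₃) (h₄ : W.a₄ = a₄)
    {u v : ℕ × ℕ × ℕ} {P Q : W.Point} (hu : ecdlpPt W u = some P) (hv : ecdlpPt W v = some Q) :
    ecdlpPt W (ecdlpAdd p a₁ a₂ a₃ a₄ u v) = some (P + Q) := by
  have hp : 0 < p := (Fact.out : p.Prime).pos
  rcases ecdlp_pt_eq_some W hu with ⟨rfl, rfl⟩ | ⟨x₁, y₁, rfl, hx₁, hy₁, n₁, rfl⟩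
  · rw [zero_add]
    unfold ecdlpAdd
    rw [if_pos rfl]
    exact hv
  · rcases ecdlp_pt_eq_some W hv with ⟨rfl, rfl⟩ | ⟨x₂, y₂, rfl, hx₂, hy₂, n₂, rfl⟩
    · rw [add_zero]
      unfold ecdlpAdd
      rw [if_neg (by simp), if_pos rfl]
      exact ecdlp_pt_affine W hx₁ hy₁ n₁
    · unfold ecdlpAdd
      rw [if_neg (show ¬ ((1, x₁, y₁) : ℕ × ℕ × ℕ).1 = 0 by simp), if_neg (show ¬ ((1, x₂, y₂) : ℕ × ℕ × ℕ).1 = 0 by simp)]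
      dsimp only
      have hneg : y₁ = ecdlpNegY p a₁ a₃ x₂ y₂ ↔ (y₁ : ZMod p) = W.negY x₂ y₂ := by
        have hlt : ecdlpNegY p a₁ a₃ x₂ y₂ < p := Nat.mod_lt _ hp
        rw [← ecdlp_natCast_negY W h₁ h₃]
        exact (ecdlp_natCast_inj hy₁ hlt).symm
      by_cases hdeg : x₁ = x₂ ∧ y₁ = ecdlpNegY p a₁ a₃ x₂ y₂
      · rw [if_pos hdeg]
        have hx : (x₁ : ZMod p) = x₂ := by rw [hdeg.1]
        rw [WeierstrassCurve.Affine.Point.add_of_Y_eq hx (hneg.1 hdeg.2)]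
        exact ecdlp_pt_zero W
      · rw [if_neg hdeg]
        have hxy : ¬ ((x₁ : ZMod p) = x₂ ∧ (y₁ : ZMod p) = W.negY x₂ y₂) := fun h =>
          hdeg ⟨(ecdlp_natCast_inj hx₁ hx₂).1 h.1, hneg.2 h.2⟩
        rw [WeierstrassCurve.Affine.Point.add_some hxy]
        have hL := ecdlp_natCast_slope W h₁ h₂ h₃ h₄ hx₁ hx₂ n₁.1 n₂.1 hxy
        have hX : ((ecdlpAddX p a₁ a₂ x₁ x₂ (ecdlpSlope p a₁ a₂ a₃ a₄ x₁ y₁ x₂ y₂) : ℕ) : ZMod p) =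
            W.addX x₁ x₂ (W.slope x₁ x₂ y₁ y₂) := by
          rw [ecdlp_natCast_addX W h₁ h₂, hL]
        have hY : ((ecdlpAddY p a₁ a₃ x₁ y₁ (ecdlpAddX p a₁ a₂ x₁ x₂ (ecdlpSlope p a₁ a₂ a₃ a₄ x₁ y₁ x₂ y₂))
            (ecdlpSlope p a₁ a₂ a₃ a₄ x₁ y₁ x₂ y₂) : ℕ) : ZMod p) = W.addY x₁ x₂ y₁ (W.slope x₁ x₂ y₁ y₂) := by
          rw [ecdlp_natCast_addY W h₁ h₃, hX, hL, WeierstrassCurve.Affine.addY, WeierstrassCurve.Affine.negAddY]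
        have n₃ : W.Nonsingular
            ((ecdlpAddX p a₁ a₂ x₁ x₂ (ecdlpSlope p a₁ a₂ a₃ a₄ x₁ y₁ x₂ y₂) : ℕ) : ZMod p)
            ((ecdlpAddY p a₁ a₃ x₁ y₁ (ecdlpAddX p a₁ a₂ x₁ x₂ (ecdlpSlope p a₁ a₂ a₃ a₄ x₁ y₁ x₂ y₂))
              (ecdlpSlope p a₁ a₂ a₃ a₄ x₁ y₁ x₂ y₂) : ℕ) : ZMod p) := by
          rw [hX, hY]
          exact WeierstrassCurve.Affine.nonsingular_add n₁ n₂ hxy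
        have bX : ecdlpAddX p a₁ a₂ x₁ x₂ (ecdlpSlope p a₁ a₂ a₃ a₄ x₁ y₁ x₂ y₂) < p := Nat.mod_lt _ hp
        have bY : ecdlpAddY p a₁ a₃ x₁ y₁ (ecdlpAddX p a₁ a₂ x₁ x₂ (ecdlpSlope p a₁ a₂ a₃ a₄ x₁ y₁ x₂ y₂))
            (ecdlpSlope p a₁ a₂ a₃ a₄ x₁ y₁ x₂ y₂) < p := Nat.mod_lt _ hp
        rw [ecdlp_pt_affine W bX bY n₃]
        congr 1
        simp only [hX, hY]

/-- **The double-and-add loop**: after the digits `< i`, the registers hold `(m mod 2^i) • P` and `2^i • P`.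
[cite: SilvermanAEC2009, XI.1] -/
theorem ecdlp_pt_foldl [DecidableEq (ZMod p)] (h₁ : W.a₁ = a₁) (h₂ : W.a₂ = a₂) (h₃ : W.a₃ = a₃) (h₄ : W.a₄ = a₄)
    (m : ℕ) {u : ℕ × ℕ × ℕ} {P : W.Point} (hu : ecdlpPt W u = some P) : ∀ i : ℕ,
    ecdlpPt W ((List.range i).foldl (fun st j => ecdlpStep p a₁ a₂ a₃ a₄ m j st) ((0, 0, 0), u)).1 =
        some ((m % 2 ^ i) • P) ∧
      ecdlpPt W ((List.range i).foldl (fun st j => ecdlpStep p a₁ a₂ a₃ a₄ m j st) ((0, 0, 0), u)).2 = some ((2 ^ i) • P)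
  | 0 => by
    rw [List.range_zero, List.foldl_nil, pow_zero, Nat.mod_one, zero_nsmul, one_nsmul]
    exact ⟨ecdlp_pt_zero W, hu⟩
  | i + 1 => by
    obtain ⟨hR, hS⟩ := ecdlp_pt_foldl h₁ h₂ h₃ h₄ m hu i
    rw [List.range_succ, List.foldl_append, List.foldl_cons, List.foldl_nil]
    constructor
    · show ecdlpPt W (if m / 2 ^ i % 2 = 1 then _ else _) = _
      rw [Nat.mod_pow_succ]
      rcases Nat.mod_two_eq_zero_or_one (m / 2 ^ i) with h0 | h0
      · rw [if_neg (by omega), h0, mul_zero, add_zero]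
        exact hR
      · rw [if_pos h0, h0, mul_one, add_nsmul]
        exact ecdlp_pt_add W h₁ h₂ h₃ h₄ hR hS
    · show ecdlpPt W (ecdlpAdd p a₁ a₂ a₃ a₄ _ _) = _
      rw [pow_succ, mul_two, add_nsmul]
      exact ecdlp_pt_add W h₁ h₂ h₃ h₄ hS hS

/-- **`ecdlpSmul` represents `m • P`** once `m < 2^B`. [cite: SilvermanAEC2009, XI.1] -/
theorem ecdlp_pt_smul [DecidableEq (ZMod p)] (h₁ : W.a₁ = a₁) (h₂ : W.a₂ = a₂) (h₃ : W.a₃ = a₃) (h₄ : W.a₄ = a₄)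
    {B m : ℕ} (hm : m < 2 ^ B) {u : ℕ × ℕ × ℕ} {P : W.Point} (hu : ecdlpPt W u = some P) :
    ecdlpPt W (ecdlpSmul p a₁ a₂ a₃ a₄ B m u) = some (m • P) := by
  have h := (ecdlp_pt_foldl W h₁ h₂ h₃ h₄ m hu B).1
  rwa [Nat.mod_eq_of_lt hm] at h


end Pt

end Summit.PneNP.PneNP.Theorems
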